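import Literature.Analysis.OperatorTheory.SimpleEigenvalueHolomorphic
import HarnessLib

/-!
# First-order perturbation of a simple eigenvalue: `P T′ P = λ′ P` (Kato II-§2.2 (2.33)/(2.36),
  `m = 1`; Hellmann–Feynman)

Analysis/OperatorTheory proofs-layer file (theorems only, no definitions, no named facts),
continuing `SimpleEigenvalueHolomorphic.lean` (`T(ϰ) P(ϰ) = λ(ϰ) P(ϰ)` with `λ`, `P`
holomorphic for a simple isolated eigenvalue). Kato II-§2.2 computes the perturbation series of
the weighted mean `λ̂(ϰ)` of the `λ`-group; its first coefficient is (2.33)/(2.36)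
`λ̂⁽¹⁾ = (1/m) tr T⁽¹⁾ P`, i.e. for a simple eigenvalue (`m = 1`, `λ̂ = λ`)
**`λ′(0) = tr T′(0) P(0)`**, equivalently `P T′ P = λ′ P` since `P` has rank one — the
Hellmann–Feynman formula `λ′ = ⟨w, T′ v⟩ / ⟨w, v⟩` with `v` a right and `w` a left eigenvector.
We derive it in a Banach algebra directly from the product rule, without series:

* `mul_deriv_mul_eq_deriv_smul_of_mul_eq_smul`: if `T(ϰ) P(ϰ) = μ(ϰ) P(ϰ)` near `ϰ₀`, `T, P, μ`
  are differentiable at `ϰ₀`, `P(ϰ₀)² = P(ϰ₀)` and `T(ϰ₀) P(ϰ₀) = P(ϰ₀) T(ϰ₀)`, then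
  **`P(ϰ₀) T′(ϰ₀) P(ϰ₀) = μ′(ϰ₀) P(ϰ₀)`** (differentiate, sandwich between two `P(ϰ₀)`; the
  terms with `P′` cancel because `P T P′ P = μ P P′ P`);
* `deriv_eigenvalue_eq_of_apply_eq` (operators): for a vector `v` with `P(ϰ₀) v = v` and a
  functional `ψ` with `ψ ∘ P(ϰ₀) = ψ` ("left eigenvector"), **`μ′(ϰ₀) ψ(v) = ψ(T′(ϰ₀) v)`**;
* `deriv_eigenvalue_branch_rieszProjection`: the same for the holomorphic branch of
  `exists_eigenvalue_branch` / Kato VII-§1.3 Thm. 1.8 with `P(ϰ) = P[T(ϰ)]` the Riesz projection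
  (whose derivative exists by `hasDerivAt_rieszProjection_comp`).

A typical use: the ratio `u = λ₁/λ₀` of two such branches is non-constant as soon as
`ψ₁(T′v₁)/ψ₁(v₁) · λ₀ ≠ ψ₀(T′v₀)/ψ₀(v₀) · λ₁` at one point (input "`u` non-constant" of
Beraha–Kahane–Weiss-type zero lemmas).

## Mathlib / tree search

Mathlib: `HasDerivAt.mul` (normed algebra), `HasDerivAt.smul`, `HasDerivAt.unique`,
`Filter.EventuallyEq.hasDerivAt_iff`; no eigenvalue perturbation formulas. Tree: the matrix
Hermitian case `Literature/Analysis/Matrix/EigenvalueBranches` (Hellmann–Feynman for Hermitian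
pencils); searched `Hellmann`, `deriv.*eigenvalue` in OperatorTheory — none for Banach spaces.

## References

* T. Kato, *Perturbation Theory for Linear Operators*, Springer 1966, II-§2.2 (2.33), (2.36)
  (held copy chunks p0112–p0113), II-§2.1 (2.5)–(2.7), VII-§1.3 Thm. 1.8. [Kato1966]
-/

noncomputable section

open Complex Metric Set Filter Topology

namespace Literature.Analysis.OperatorTheory

/-! ### The sandwich identity in a Banach algebra -/

section BanachAlgebra

variable {A : Type*} [NormedRing A] [NormedAlgebra ℂ A]

/-- **`P T′ P = μ′ P` (Kato II-(2.36) for `m = 1`).** Let `T(ϰ) P(ϰ) = μ(ϰ) P(ϰ)` for `ϰ`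
near `ϰ₀`, with `T`, `P`, `μ` differentiable at `ϰ₀` (derivatives `T′`, `P′`, `μ′`),
`P(ϰ₀)² = P(ϰ₀)` and `T(ϰ₀) P(ϰ₀) = P(ϰ₀) T(ϰ₀)`. Then `P(ϰ₀) T′ P(ϰ₀) = μ′ • P(ϰ₀)`.
(Product rule: `T′P + TP′ = μ′P + μP′` at `ϰ₀`; multiply by `P(ϰ₀)` on both sides and use
`P T P′ P = μ P P′ P`.) [cite: Kato1966, II-§2.2 (2.33) and (2.36)] -/
theorem mul_deriv_mul_eq_deriv_smul_of_mul_eq_smul {T P : ℂ → A} {μ : ℂ → ℂ} {T' P' : A}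
    {μ' : ℂ} {a₀ : ℂ} (hTP : ∀ᶠ a in 𝓝 a₀, T a * P a = μ a • P a) (hT : HasDerivAt T T' a₀)
    (hP : HasDerivAt P P' a₀) (hμ : HasDerivAt μ μ' a₀) (hPP : P a₀ * P a₀ = P a₀)
    (hc : Commute (T a₀) (P a₀)) :
    P a₀ * T' * P a₀ = μ' • P a₀ := by
  -- the two derivatives of the same function
  have h1 : HasDerivAt (fun a => T a * P a) (T' * P a₀ + T a₀ * P') a₀ :=
    (hT.mul hP).congr_of_eventuallyEq (Eventually.of_forall fun _ => rfl)
  have h2 : HasDerivAt (fun a => μ a • P a) (μ a₀ • P' + μ' • P a₀) a₀ := hμ.smul hP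
  have h2' : HasDerivAt (fun a => T a * P a) (μ a₀ • P' + μ' • P a₀) a₀ :=
    (Filter.EventuallyEq.hasDerivAt_iff hTP).2 h2
  have heq : T' * P a₀ + T a₀ * P' = μ a₀ • P' + μ' • P a₀ := h1.unique h2'
  -- the identity at `a₀` itself
  have h0 : T a₀ * P a₀ = μ a₀ • P a₀ := hTP.self_of_nhds
  -- sandwich between two copies of `P a₀`
  have hs := congrArg (fun X : A => P a₀ * X * P a₀) heq
  simp only [mul_add, add_mul, mul_smul_comm, smul_mul_assoc] at hs
  -- `P T P' P = μ P P' P` (from `P T = T P = μ P`) and `P P P = P`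
  have hPT : P a₀ * T a₀ = μ a₀ • P a₀ := by rw [← hc.eq, h0]
  rw [show P a₀ * (T a₀ * P') * P a₀ = μ a₀ • (P a₀ * P' * P a₀) by
      rw [← mul_assoc, hPT, smul_mul_assoc, smul_mul_assoc],
    show P a₀ * (T' * P a₀) * P a₀ = P a₀ * T' * P a₀ by rw [← mul_assoc, mul_assoc _ _ (P a₀), hPP],
    show P a₀ * P a₀ * P a₀ = P a₀ by rw [hPP, hPP],
    show P a₀ * P' * P a₀ = P a₀ * P' * P a₀ from rfl] at hs
  -- cancel the common term
  have := hs
  rw [add_comm (μ a₀ • (P a₀ * P' * P a₀)) (μ' • P a₀)] at this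
  exact add_right_cancel this

end BanachAlgebra

/-! ### Operators: the Hellmann–Feynman form with a right and a left eigenvector -/

section Operator

variable {E : Type*} [NormedAddCommGroup E] [NormedSpace ℂ E]

/-- **`μ′(ϰ₀) ψ(v) = ψ(T′(ϰ₀) v)`** for a vector `v` fixed by `P(ϰ₀)` and a functional `ψ`
invariant under `P(ϰ₀)` (right and left eigenvectors of the simple eigenvalue): the
Hellmann–Feynman / Kato II-(2.36) formula `λ′ = ⟨w, T′v⟩/⟨w, v⟩` in Banach-space form.
[cite: Kato1966, II-§2.2 (2.33) and (2.36)] -/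
theorem deriv_eigenvalue_mul_eq_of_apply_eq {T P : ℂ → E →L[ℂ] E} {μ : ℂ → ℂ}
    {T' P' : E →L[ℂ] E} {μ' : ℂ} {a₀ : ℂ} (hTP : ∀ᶠ a in 𝓝 a₀, T a * P a = μ a • P a)
    (hT : HasDerivAt T T' a₀) (hP : HasDerivAt P P' a₀) (hμ : HasDerivAt μ μ' a₀)
    (hPP : P a₀ * P a₀ = P a₀) (hc : Commute (T a₀) (P a₀)) {v : E} (hv : P a₀ v = v)
    {ψ : E →L[ℂ] ℂ} (hψ : ∀ x, ψ (P a₀ x) = ψ x) : μ' * ψ v = ψ (T' v) := by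
  have h := mul_deriv_mul_eq_deriv_smul_of_mul_eq_smul hTP hT hP hμ hPP hc
  have h1 := congrArg (fun X : E →L[ℂ] E => ψ (X v)) h
  simp only [mul_apply_eq_comp, smul_apply, hv, hψ, map_smul, smul_eq_mul] at h1
  exact h1.symm

/-- In particular, with `ψ v = 1`: **`μ′(ϰ₀) = ψ(T′(ϰ₀) v)`**. [cite: Kato1966, II-§2.2 (2.33) and (2.36)] -/
theorem deriv_eigenvalue_eq_of_apply_eq {T P : ℂ → E →L[ℂ] E} {μ : ℂ → ℂ}
    {T' P' : E →L[ℂ] E} {μ' : ℂ} {a₀ : ℂ} (hTP : ∀ᶠ a in 𝓝 a₀, T a * P a = μ a • P a)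
    (hT : HasDerivAt T T' a₀) (hP : HasDerivAt P P' a₀) (hμ : HasDerivAt μ μ' a₀)
    (hPP : P a₀ * P a₀ = P a₀) (hc : Commute (T a₀) (P a₀)) {v : E} (hv : P a₀ v = v)
    {ψ : E →L[ℂ] ℂ} (hψ : ∀ x, ψ (P a₀ x) = ψ x) (hψv : ψ v = 1) : μ' = ψ (T' v) := by
  simpa [hψv] using deriv_eigenvalue_mul_eq_of_apply_eq hTP hT hP hμ hPP hc hv hψ

end Operator

/-! ### The holomorphic branch of a simple isolated eigenvalue (Kato VII-§1.3 Thm. 1.8) -/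

section Riesz

variable {E : Type*} [NormedAddCommGroup E] [NormedSpace ℂ E] [CompleteSpace E]

/-- **First-order formula for the Riesz branch.** In the situation of `exists_eigenvalue_branch`
(holomorphic `T` on an open `U ∋ ϰ₀`, circle `C(c,R) ⊆ ρ(T(ϰ₀))`, and
`T(ϰ) P[T(ϰ)] = μ(ϰ) P[T(ϰ)]` on a ball around `ϰ₀` with `μ` differentiable there), for every
`v` with `P[T(ϰ₀)] v = v` and every functional `ψ` with `ψ ∘ P[T(ϰ₀)] = ψ`:
`deriv μ ϰ₀ · ψ(v) = ψ(T′(ϰ₀) v)` (Kato II-(2.36), `m = 1`, transported to `𝓑(X)` by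
VII-§1.3). [cite: Kato1966, II-§2.2 (2.36) and VII-§1.3 Thm. 1.8] -/
theorem deriv_eigenvalue_branch_rieszProjection {T : ℂ → E →L[ℂ] E} {U : Set ℂ}
    (hU : IsOpen U) (hT : DifferentiableOn ℂ T U) {a₀ : ℂ} (ha₀ : a₀ ∈ U) {c : ℂ} {R : ℝ}
    (hR : 0 < R) (hs : sphere c R ⊆ resolventSet ℂ (T a₀)) {ε : ℝ} (hε : 0 < ε)
    {μ : ℂ → ℂ} (hμd : DifferentiableOn ℂ μ (ball a₀ ε))
    (hμ : ∀ a ∈ ball a₀ ε, T a * rieszProjection (T a) c R = μ a • rieszProjection (T a) c R)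
    {v : E} (hv : rieszProjection (T a₀) c R v = v) {ψ : E →L[ℂ] ℂ}
    (hψ : ∀ x, ψ (rieszProjection (T a₀) c R x) = ψ x) :
    deriv μ a₀ * ψ v = ψ (deriv T a₀ v) := by
  have hball : ball a₀ ε ∈ 𝓝 a₀ := ball_mem_nhds a₀ hε
  have hTP : ∀ᶠ a in 𝓝 a₀, T a * rieszProjection (T a) c R = μ a • rieszProjection (T a) c R :=
    Filter.eventually_of_mem hball hμ
  exact deriv_eigenvalue_mul_eq_of_apply_eq (P := fun a => rieszProjection (T a) c R) hTP
    (hT.hasDerivAt (hU.mem_nhds ha₀)) (hasDerivAt_rieszProjection_comp hU hT ha₀ hR.le hs)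
    (hμd.hasDerivAt hball) (rieszProjection_mul_self hR hs)
    (commute_rieszProjection hR.le hs) hv hψ

end Riesz

end Literature.Analysis.OperatorTheory
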